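import Literature.Topology.FourManifolds.KirbyMovesSlideSweepLift
import HarnessLib

/-!
# The handle-slide sweep in the surgered manifold: pushing the slice-wise lift along a tube

Topic `Literature/Topology/FourManifolds`; fact seat `provefact-IsStrictHandleSlide.isSurgery`
(R. C. Kirby, *The Topology of 4-Manifolds*, LNM 1374 (1989), Ch. I §4, p. 10 and §5 Thm. 5.1
(1); remaining content in the tree: the named fact (S)
`Literature.Topology.FourManifolds.FramedLink.IsStrictHandleSlide.slideModel`,
`KirbyMovesHandleSlide.lean`). The sweep across the meridian disc `Δ` of the new solid torus of
`Yⱼ = ∂(B⁴ ∪ hⱼ)` is obtained from a compactly supported planar isotopy `σ` of a meridian slice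
(`KirbyMovesSlideSweepExchange2.lean`), lifted slice-wise with a bump `β` on the circle
(`exists_tubeIsotopy_sliceLift`, `KirbyMovesSlideSweepLift.lean`) and pushed into the ambient
3-manifold along a tube `Ψ : S¹ × ℝ² ↪ X` (`TubeNbhd.tubeIsotopyPush`,
`TubeIsotopyPushforward.lean`; for the slide `Ψ` is the surgered tube `exists_surgeredTube` of
`KirbyMovesSlideTransport.lean`). Proved here, no definitions, no named facts:

* `Literature.Topology.FourManifolds.SlideSweep.exists_pillboxSweep` — for a tube `Ψ` around a
  circle in a Hausdorff 3-manifold `X`, a planar ambient isotopy `σ` stationary off a disc and a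
  smooth `β : S¹ → ℝ`, an ambient isotopy `F` of `X` with `F t (Ψ (v, p)) = Ψ (v, σ (t β(v)) p)`
  and `F t = id` off the image of `Ψ` (Hirsch, *Differential Topology* (1976), Ch. 8 §1,
  p. 179: extension by the identity of a compactly supported isotopy of an open subset).

## References

* R. C. Kirby, *The Topology of 4-Manifolds*, LNM 1374, Springer (1989), Ch. I §4, §5 Thm. 5.1.
  [Kirby1989]
* M. W. Hirsch, *Differential Topology*, GTM 33, Springer (1976), Ch. 8 §1 (pp. 178–179).
  [HirschDT1976]
-/

open scoped Manifold ContDiff Topology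
open Function Set Metric

noncomputable section

namespace Literature.Topology.FourManifolds

namespace SlideSweep

universe u

/-- **The pillbox sweep.** Let `X` be a Hausdorff `3`-manifold, `Ψ` a tube around a circle in
`X`, `σ` an ambient isotopy of the plane all of whose stages are the identity off the closed disc
of radius `ρ`, and `β : S¹ → ℝ` smooth. Then there is an ambient isotopy `F` of `X` with
`F t (Ψ (v, p)) = Ψ (v, σ (t β(v)) p)` for all `t`, `v`, `p`, which is the identity off the image of
`Ψ`. (Lift `σ` slice-wise, `exists_tubeIsotopy_sliceLift`, and push the lift along `Ψ`,
`TubeNbhd.tubeIsotopyPush`.) [cite: HirschDT1976, Ch. 8 §1] -/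
theorem exists_pillboxSweep {X : Type u} [TopologicalSpace X]
    [ChartedSpace (EuclideanSpace ℝ (Fin 3)) X] [T2Space X] [IsManifold (𝓡 3) ∞ X]
    {core : Metric.sphere (0 : EuclideanSpace ℝ (Fin 2)) 1 → X} (Ψ : TubeNbhd (𝓡 3) core)
    (σ : AmbientIsotopy 𝓘(ℝ, EuclideanSpace ℝ (Fin 2)) (EuclideanSpace ℝ (Fin 2))) {ρ : ℝ}
    (hσ : ∀ t (p : EuclideanSpace ℝ (Fin 2)), ρ ≤ ‖p‖ → σ.toFun t p = p)
    {β : Metric.sphere (0 : EuclideanSpace ℝ (Fin 2)) 1 → ℝ} (hβ : ContMDiff (𝓡 1) 𝓘(ℝ, ℝ) ∞ β) :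
    ∃ F : AmbientIsotopy (𝓡 3) X,
      (∀ (t : ℝ) (v : Metric.sphere (0 : EuclideanSpace ℝ (Fin 2)) 1) (p : EuclideanSpace ℝ (Fin 2)),
        F.toFun t (Ψ.toFun (v, p)) = Ψ.toFun (v, σ.toFun (t * β v) p)) ∧
      (∀ (t : ℝ) (y : X), y ∉ range Ψ.toFun → F.toFun t y = y) := by
  obtain ⟨Θ, -, hΘ⟩ := exists_tubeIsotopy_sliceLift σ hσ hβ
  set ν : Unit → TubeNbhd (𝓡 3) core := fun _ ↦ Ψ with hν
  have hdisj : Pairwise fun i j : Unit ↦ Disjoint (range (ν i).toFun) (range (ν j).toFun) :=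
    Subsingleton.pairwise
  refine ⟨TubeNbhd.tubeIsotopyPush ν hdisj (fun _ ↦ Θ), fun t v p ↦ ?_, fun t y hy ↦ ?_⟩
  · have h := TubeNbhd.tubeIsotopyPush_apply_toFun (ν := ν) hdisj (fun _ ↦ Θ) t () (v, p)
    simp only [hν] at h ⊢
    rw [h, hΘ]
  · exact TubeNbhd.tubeIsotopyPush_apply_of_forall_not_mem hdisj (fun _ ↦ Θ) t (fun _ ↦ hy)

end SlideSweep

end Literature.Topology.FourManifolds
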